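import Literature.AlgebraicGeometry.HodgeTheory.BettiHodgeConjectureProductsHodgeNumberWindowCriterion
import Literature.AlgebraicGeometry.HodgeTheory.BettiHodgeConjectureProductsOffMiddleAlgebraicFactor
import Literature.AlgebraicGeometry.HodgeTheory.CubicFourfoldHodgeConjectureAllDegrees
import Literature.AlgebraicGeometry.HodgeTheory.CubicFourfoldHodgeConjectureHolds
import Literature.AlgebraicGeometry.HodgeTheory.HardLefschetzNFoldHolds
import Literature.AlgebraicGeometry.HodgeTheory.ComplexConjugationHolds
import Literature.AlgebraicGeometry.Motives.HodgeTensorFactsHolds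
import HarnessLib

/-!
# `HC(F × X)` for a smooth projective FOURFOLD `F` in Hodge numbers; `F × T`, `F × F'`; the smooth cubic fourfold: `HC(X₃ × C)`, `HC(X₃ × S)` for `p_g(S) = 0`, `HC(X₃ × T)` for `h^{2,0}(T) = 0`,
# unconditionally (Voisin I §6.1.3 Cor. 6.13, §7.1.1, §11.3.3 Thm. 11.38–11.40, Lemma 11.41, pp. 285–287, Thm. 11.30; Voisin II Cor. 1.24–1.25, Prop. 9.20, proof of Prop. 10.26; Zucker 1977 Thm. (3.2); Murre 1977)

Family `hodge`, lane `lit-hodgefound` (Track 2 foundations library; Layers A1/A4), layer `Literature/AlgebraicGeometry/HodgeTheory`.  THEOREMS ONLY (no definition, no named fact, no instance;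
D-0026 net debt `0`).  Sequel of the seat's g33-#1 (`BettiHodgeConjectureProductsHodgeNumberWindowCriterion`: the reduced-window criterion for `HC(Y × Z)` in Hodge numbers, and the dimension
pairs `3 × n`, `3 × 3`): here the first factor is a FOURFOLD `F` (conditional on `HC(F)`, which is open in dimension `4`).  The reduced window of `F × X` has the pieces `H¹(F) ⊗ H^{2b+1}(X)` (`1 ≤ b`),
`H²(F) ⊗ H^{2b}(X)` (`1 ≤ b`), `H³(F) ⊗ H^{2b+1}(X)` (`0 ≤ b`) and `H⁴(F) ⊗ H^{2b}(X)` (`1 ≤ b`); the last always contains the type `(2,2) + (b,b) = (c,c)` with `h^{2,2}(F) h^{b,b}(X) ≠ 0`, so it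
must drop out of the reduced window — `Hdg²(H⁴(F)) = H⁴(F;ℚ)` (`h^{4,0}(F) = h^{3,1}(F) = 0`, §1) or `Hdgᵇ(H^{2b}(X)) = H^{2b}(X;ℚ)` — exactly as `H²(F) ⊗ H^{2b}(X)` must (`h^{2,0}(F) = 0` or
`Hdgᵇ(H^{2b}(X)) = ⊤`).  §3/§4 read the criterion for `X = T` a threefold (`HC(T)` is the tree's `hodgeConjectureFor_of_dim_le_three_holds`) and `X = F'` a second fourfold.  §5 is UNCONDITIONAL: for
a smooth CUBIC FOURFOLD `X₃ ⊂ ℙ⁵` the tree proves `HC(X₃)` (Zucker 1977 / Murre 1977: the named fact `hodgeTwoTwo_algebraic_cubicFourfold` is DISCHARGED by `hodgeTwoTwo_algebraic_cubicFourfold_holds`,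
and `hodgeConjectureFor_cubicFourfold_of` assembles `HC(X₃)` from it, Lefschetz `(1,1)` (`lefschetzOneOne_rational_holds`), hard Lefschetz (`nonempty_hardLefschetzNFold_holds`) and the Hodge
model (`nonempty_hodgeModel_holds`)) — recorded here as `hodgeConjectureFor_cubicFourfold_holds` — and `b₁(X₃) = b₃(X₃) = 0`, `Hdg¹(H²(X₃)) = H²(X₃;ℚ)` (Voisin II Cor. 1.24–1.25, the tree's
`IsSmoothHypersurface.finrank_bettiCohomology_eq_zero_of_odd` / `…hodgeClasses_hodge_eq_top_of_two_mul_ne`), so `h^{1,0} = h^{2,0} = h^{2,1} = h^{3,0} = 0` while `h^{3,1}(X₃) = 1 ≠ 0`; whence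
**`HC(X₃ × C)` for every curve, `HC(X₃ × S)` for every surface with `p_g(S) = 0`, and `HC(X₃ × T)` for every threefold with `h^{2,0}(T) = 0`**.  (For `p_g(S) ≠ 0`, resp. `h^{2,0}(T) ≠ 0`, the piece
`H⁴(X₃) ⊗ H²` carries the Hodge classes = morphisms of Hodge structures from the transcendental part of `H²` to `H⁴(X₃)(1)`, K3-type questions not settled by Hodge numbers.)

WHAT IS PROVED.
* §1 **`BettiUniverse.hodgeClasses_hodge_four_eq_top_iff`**: `Hdg²(H⁴(X)) = H⁴(X;ℚ) ⟺ h^{4,0}(H⁴X) = 0 ∧ h^{3,1}(H⁴X) = 0`.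
* §2 **`BettiUniverse.hodgeConjectureFor_fourfold_tensor_of_hodgeNumber_mul_eq_zero`**: `HC(F × X)` from `HC(F)`, `HC(X)`, `h^{1,0}(F)·h^{b,b+1}(H^{2b+1}X) = 0` (`1 ≤ b`), [`h^{2,0}(F) = 0` or
  `Hdgᵇ(H^{2b}X) = ⊤`] (`1 ≤ b`), `h^{2,1}(F)·h^{b,b+1}(H^{2b+1}X) = 0`, `h^{3,0}(F)·h^{u,u+3}(H^{2u+3}X) = 0`, [`Hdg²(H⁴F) = ⊤` or `Hdgᵇ(H^{2b}X) = ⊤`] (`1 ≤ b`), all within `j ≤ n`.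
* §3 **`BettiUniverse.hodgeConjectureFor_fourfold_tensor_threefold_of_hodgeNumber_mul_eq_zero`** (`F × T`: `HC(F)`, `h^{1,0}h'^{2,1} = h^{2,0}h'^{2,0} = h^{2,1}h'^{1,0} = h^{2,1}h'^{2,1} = h^{3,0}h'^{3,0} = 0`
  and [`Hdg²(H⁴F) = ⊤` or `h^{2,0}(T) = 0`]) and **`…_of_hodgeNumber_eq_zero`** (`T` with `h^{1,0} = h^{2,0} = h^{2,1} = 0` and `h^{3,0}(F)h^{3,0}(T) = 0`: `HC(F) ⟹ HC(F × T)`).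
* §4 **`BettiUniverse.hodgeConjectureFor_tensor_fourfolds_of_hodgeNumber_mul_eq_zero`** (`F × F'`).
* §5 **`hodgeConjectureFor_cubicFourfold_holds`** (`HC(X₃)` for every smooth cubic fourfold, assembled from the tree's discharges), **`IsSmoothHypersurface.hodgeNumber_*_cubicFourfold`**
  (`h^{1,0} = h^{2,0} = h^{2,1} = h^{3,0} = 0`), **`IsSmoothHypersurface.hodgeConjectureFor_cubicFourfold_tensor_curve`**, **`…_tensor_surface_of_pg_zero`**, **`…_tensor_threefold_of_h20_zero`**.

THE PRINTS.  C. Voisin (2002) [VoisinHodgeI2002] §6.1.3 Cor. 6.13; §7.1.1; §11.3.1 Thm. 11.30; §11.3.3 Thm. 11.38–11.40, Lemma 11.41 and pp. 285–287.  C. Voisin (2003) [VoisinHodgeII2003] §1.2.3 Cor. 1.24–1.25 (Lefschetz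
for hypersurfaces); §9.2.4 Prop. 9.20; §10.2.3 proof of Prop. 10.26; §11.1.1.  S. Zucker (1977) [Zucker1977] (3.2) Theorem, p. 206.  J. P. Murre (1977) [Murre1977] Theorem and Corollary, p. 230.
P. Deligne (1971) [DeligneHodgeII1971] 1.2.5, 2.1.13.  P. Deligne (2000/2006) [Deligne2000] §1.

THE OBJECTS (all the tree's).  `BettiUniverse.hodge`, `HodgeStructure.hodgeNumber`, `hodgeClasses`, `bettiCohomology`, `HodgeConjectureFor`, `Motives.IsSmoothHypersurface 4 3`,
`hodgeTwoTwo_algebraic_cubicFourfold(_holds)`, `hodgeConjectureFor_cubicFourfold_of`, `lefschetzOneOne_rational_holds`, `nonempty_hardLefschetzNFold_holds`, `nonempty_hodgeModel_holds`,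
`hodgeTensorFacts_holds`, `IsSmoothProjective.tensor_holds`, and the seat's g33-#1 `BettiUniverse.hodgeConjectureFor_tensor_of_forall_reducedWindow_hodgeNumber_mul_eq_zero`.

DEVIATIONS / SCOPE.  Complex orientations (through g31-#14/#16).  §2–§4 keep the instance hypothesis `[HodgeTensorFacts.{0,0}]` and an arbitrary smooth-projective structure `hFX` on the product, as in
g33-#1; the unconditional §5 discharges both (`hodgeTensorFacts_holds`, `IsSmoothProjective.tensor_holds`).  No definitions.

## References
* [VoisinHodgeI2002] C. Voisin, *Hodge Theory and Complex Algebraic Geometry I* (2002) — §6.1.3 Cor. 6.13; §7.1.1; §11.3.1 Thm. 11.30; §11.3.3 Thm. 11.38–11.40, Lemma 11.41, pp. 285–287.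
* [VoisinHodgeII2003] C. Voisin, *Hodge Theory and Complex Algebraic Geometry II* (2003) — §1.2.3 Cor. 1.24–1.25; §9.2.4 Prop. 9.20; §10.2.3 proof of Prop. 10.26; §11.1.1.
* [Zucker1977] S. Zucker, The Hodge conjecture for cubic fourfolds, Compositio Math. 34 (1977) — (3.2) Theorem, p. 206.
* [Murre1977] J. P. Murre, On the Hodge conjecture for unirational fourfolds, Indag. Math. 80 (1977) — Theorem and Corollary, p. 230.
* [DeligneHodgeII1971] P. Deligne, *Théorie de Hodge II* (1971) — 1.2.5, 2.1.13.
* [Deligne2000] P. Deligne, *The Hodge conjecture* (Clay problem description) — §1.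

## Provenance
Lane `lit-hodgefound` (Hodge path, Track 2), prover seat `lit-hodgefound-p29` (generation 33), self-proposed row g33-#2 (sequel of g33-#1: the dimension pairs `4 × n`, `4 × 3`, `4 × 4`, and the
unconditional cubic-fourfold products).
-/

noncomputable section

open scoped TensorProduct
open CategoryTheory MonoidalCategory CartesianMonoidalCategory Module Finset
open Literature.AlgebraicTopology.SingularHomology
open Literature.Geometry.Kaehler

namespace Literature.AlgebraicGeometry.HodgeTheory

open Literature.AlgebraicGeometry.Motives
open Literature.AlgebraicGeometry.Motives.HodgeStructure

variable {n d : ℕ} {X F F' T : SchemeOver ℂ}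

/-! ### §1 `Hdg²(H⁴(X)) = H⁴(X;ℚ)` in Hodge numbers -/

/-- **`Hdg²(H⁴(X)) = H⁴(X;ℚ) ⟺ h^{4,0}(H⁴(X)) = 0 ∧ h^{3,1}(H⁴(X)) = 0`** (every rational class of degree `4` is a Hodge class iff the types `(4,0)`, `(3,1)` — and by Hodge symmetry `(1,3)`, `(0,4)`
— are absent). [cite: VoisinHodgeI2002, §7.1.1 and §11.3.3 p. 285] [cite: DeligneHodgeII1971, 2.1.13] -/
theorem BettiUniverse.hodgeClasses_hodge_four_eq_top_iff (hHD : exists_isReal_hodgeModel) (hX : IsSmoothProjective n X) :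
    (BettiUniverse.hodge hHD hX 4).hodgeClasses 2 = ⊤ ↔ (BettiUniverse.hodge hHD hX 4).hodgeNumber 4 0 = 0 ∧ (BettiUniverse.hodge hHD hX 4).hodgeNumber 3 1 = 0 := by
  refine ⟨fun h ↦ ⟨(BettiUniverse.hodge hHD hX 4).hodgeNumber_eq_zero_of_hodgeClasses_eq_top (by norm_num) h (by norm_num),
    (BettiUniverse.hodge hHD hX 4).hodgeNumber_eq_zero_of_hodgeClasses_eq_top (by norm_num) h (by norm_num)⟩, fun ⟨h40, h31⟩ ↦ ?_⟩
  refine BettiUniverse.hodgeClasses_hodge_eq_top_of_forall_hodgeNumber_eq_zero hHD hX (by norm_num) fun a b hab ha2 ↦ ?_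
  have h04 : (BettiUniverse.hodge hHD hX 4).hodgeNumber 0 4 = 0 := by rw [BettiUniverse.hodgeNumber_hodge_symm hHD hX 4 (0 : ℤ) 4]; exact h40
  have h13 : (BettiUniverse.hodge hHD hX 4).hodgeNumber 1 3 = 0 := by rw [BettiUniverse.hodgeNumber_hodge_symm hHD hX 4 (1 : ℤ) 3]; exact h31
  have ha4 : a ≤ 4 := by omega
  interval_cases a
  · obtain rfl : b = 4 := by omega
    exact_mod_cast h04
  · obtain rfl : b = 3 := by omega
    exact_mod_cast h13
  · exact absurd rfl (by exact_mod_cast ha2 : (2 : ℤ) ≠ 2)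
  · obtain rfl : b = 1 := by omega
    exact_mod_cast h31
  · obtain rfl : b = 0 := by omega
    exact_mod_cast h40

variable [HodgeTensorFacts.{0, 0}]

/-! ### §2 A fourfold times an `n`-fold -/

/-- **`HC(F × X)` for a smooth projective fourfold `F` with `HC(F)` and a smooth projective `n`-fold `X` with `HC(X)`, in Hodge numbers.**  The reduced window of `F × X` has the pieces `H¹(F) ⊗ H^{2b+1}(X)`
(`1 ≤ b`: `h^{1,0}(F)·h^{b,b+1} = 0`), `H³(F) ⊗ H^{2b+1}(X)` (`h^{2,1}(F)·h^{b,b+1} = 0`, `h^{3,0}(F)·h^{u,u+3}(H^{2u+3}X) = 0`) and the two even pieces `H²(F) ⊗ H^{2b}(X)`, `H⁴(F) ⊗ H^{2b}(X)`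
(`1 ≤ b`), which always contain a type adding up to `(c,c)` (`(1,1)+(b,b)`, `(2,2)+(b,b)`) and must drop out of the reduced window: `h^{2,0}(F) = 0` or `Hdgᵇ(H^{2b}X) = ⊤`, resp. `Hdg²(H⁴F) = ⊤` or
`Hdgᵇ(H^{2b}X) = ⊤`. [cite: VoisinHodgeI2002, §7.1.1, §6.1.3 Cor. 6.13, §11.3.3 Thm. 11.38–11.40, Lemma 11.41 and pp. 285–287, §11.3.1 Thm. 11.30] [cite: VoisinHodgeII2003, §9.2.4 Prop. 9.20]
[cite: DeligneHodgeII1971, 1.2.5 and 2.1.13] [cite: Deligne2000, §1] -/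
theorem BettiUniverse.hodgeConjectureFor_fourfold_tensor_of_hodgeNumber_mul_eq_zero (hHD : exists_isReal_hodgeModel) (hF : IsSmoothProjective 4 F) (hX : IsSmoothProjective n X)
    (hFX : IsSmoothProjective d (F ⊗ X)) (hHCF : HodgeConjectureFor 4 F) (hHCX : HodgeConjectureFor n X)
    (h10 : ∀ b : ℕ, 1 ≤ b → 2 * b + 1 ≤ n → (BettiUniverse.hodge hHD hF 1).hodgeNumber 1 0 * (BettiUniverse.hodge hHD hX (2 * b + 1)).hodgeNumber b (b + 1) = 0)
    (h20 : ∀ b : ℕ, 1 ≤ b → 2 * b ≤ n → (BettiUniverse.hodge hHD hF 2).hodgeNumber 2 0 = 0 ∨ (BettiUniverse.hodge hHD hX (2 * b)).hodgeClasses b = ⊤)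
    (h21 : ∀ b : ℕ, 2 * b + 1 ≤ n → (BettiUniverse.hodge hHD hF 3).hodgeNumber 2 1 * (BettiUniverse.hodge hHD hX (2 * b + 1)).hodgeNumber b (b + 1) = 0)
    (h30 : ∀ u : ℕ, 2 * u + 3 ≤ n → (BettiUniverse.hodge hHD hF 3).hodgeNumber 3 0 * (BettiUniverse.hodge hHD hX (2 * u + 3)).hodgeNumber u (u + 3) = 0)
    (h4 : ∀ b : ℕ, 1 ≤ b → 2 * b ≤ n → (BettiUniverse.hodge hHD hF 4).hodgeClasses 2 = ⊤ ∨ (BettiUniverse.hodge hHD hX (2 * b)).hodgeClasses b = ⊤) :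
    HodgeConjectureFor d (F ⊗ X) := by
  refine BettiUniverse.hodgeConjectureFor_tensor_of_forall_reducedWindow_hodgeNumber_mul_eq_zero hHD hF hX hFX hHCF hHCX
    fun c i j hc hi him hj hjn hij _ _ hnF hnX P Q hPQ ↦ ?_
  -- a negative index on the `F` side kills the product
  by_cases hP0 : P < 0
  · rw [BettiUniverse.hodgeNumber_hodge_eq_zero_of_neg_left hHD hF i Q hP0, zero_mul]
  by_cases hQ0 : Q < 0
  · rw [BettiUniverse.hodgeNumber_hodge_eq_zero_of_neg_right hHD hF i P hQ0, zero_mul]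
  have hi4 : i ≤ 4 := him
  interval_cases i
  · -- `H¹(F) ⊗ H^{2b+1}(X)`, `c = b + 1`, `1 ≤ b`
    obtain ⟨b, rfl⟩ : ∃ b, j = 2 * b + 1 := ⟨c - 1, by omega⟩
    obtain rfl : c = b + 1 := by omega
    have key := h10 b (by omega) hjn
    rcases (show P = 0 ∧ Q = 1 ∨ P = 1 ∧ Q = 0 by omega) with ⟨rfl, rfl⟩ | ⟨rfl, rfl⟩
    · rw [BettiUniverse.hodgeNumber_hodge_symm hHD hF 1 (1 : ℤ) 0, BettiUniverse.hodgeNumber_hodge_symm hHD hX (2 * b + 1) (b : ℤ) (b + 1)] at key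
      convert key using 3 <;> omega
    · convert key using 3 <;> omega
  · -- `H²(F) ⊗ H^{2b}(X)` is not in the reduced window
    obtain ⟨b, rfl⟩ : ∃ b, j = 2 * b := ⟨c - 1, by omega⟩
    rcases h20 b (by omega) hjn with h | h
    · exact (hnF 1 (by omega) ((BettiUniverse.hodgeClasses_hodge_two_eq_top_iff hHD hF).2 h)).elim
    · exact (hnX b rfl h).elim
  · -- `H³(F) ⊗ H^{2c−3}(X)`
    rcases (show P = 0 ∧ Q = 3 ∨ P = 1 ∧ Q = 2 ∨ P = 2 ∧ Q = 1 ∨ P = 3 ∧ Q = 0 by omega) with ⟨rfl, rfl⟩ | ⟨rfl, rfl⟩ | ⟨rfl, rfl⟩ | ⟨rfl, rfl⟩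
    · by_cases hc2 : c = 2
      · subst hc2
        rw [BettiUniverse.hodgeNumber_hodge_eq_zero_of_neg_right hHD hX j _ (by norm_num : ((2 : ℕ) : ℤ) - 3 < 0), mul_zero]
      obtain ⟨u, rfl⟩ : ∃ u, j = 2 * u + 3 := ⟨c - 3, by omega⟩
      obtain rfl : c = u + 3 := by omega
      have key := h30 u hjn
      rw [BettiUniverse.hodgeNumber_hodge_symm hHD hF 3 (3 : ℤ) 0, BettiUniverse.hodgeNumber_hodge_symm hHD hX (2 * u + 3) (u : ℤ) (u + 3)] at key
      convert key using 3 <;> omega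
    · obtain ⟨b, rfl⟩ : ∃ b, j = 2 * b + 1 := ⟨c - 2, by omega⟩
      obtain rfl : c = b + 2 := by omega
      have key := h21 b hjn
      rw [BettiUniverse.hodgeNumber_hodge_symm hHD hF 3 (2 : ℤ) 1, BettiUniverse.hodgeNumber_hodge_symm hHD hX (2 * b + 1) (b : ℤ) (b + 1)] at key
      convert key using 3 <;> omega
    · obtain ⟨b, rfl⟩ : ∃ b, j = 2 * b + 1 := ⟨c - 2, by omega⟩
      obtain rfl : c = b + 2 := by omega
      have key := h21 b hjn
      convert key using 3 <;> omega
    · by_cases hc2 : c = 2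
      · subst hc2
        rw [BettiUniverse.hodgeNumber_hodge_eq_zero_of_neg_left hHD hX j _ (by norm_num : ((2 : ℕ) : ℤ) - 3 < 0), mul_zero]
      obtain ⟨u, rfl⟩ : ∃ u, j = 2 * u + 3 := ⟨c - 3, by omega⟩
      obtain rfl : c = u + 3 := by omega
      have key := h30 u hjn
      convert key using 3 <;> omega
  · -- `H⁴(F) ⊗ H^{2b}(X)` is not in the reduced window (`c = b + 2`, `1 ≤ b`)
    obtain ⟨b, rfl⟩ : ∃ b, j = 2 * b := ⟨c - 2, by omega⟩
    rcases h4 b (by omega) hjn with h | h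
    · exact (hnF 2 (by omega) h).elim
    · exact (hnX b rfl h).elim

/-! ### §3 A fourfold times a threefold -/

/-- **`HC(F × T)` for a smooth projective fourfold `F` with `HC(F)` and a smooth projective threefold `T` with `h^{1,0}(F)·h^{2,1}(T) = 0`, `h^{2,0}(F)·h^{2,0}(T) = 0`, `h^{2,1}(F)·h^{1,0}(T) = 0`,
`h^{2,1}(F)·h^{2,1}(T) = 0`, `h^{3,0}(F)·h^{3,0}(T) = 0` and [`Hdg²(H⁴(F)) = H⁴(F;ℚ)` or `h^{2,0}(T) = 0`]** (`HC(T)` is the tree's `hodgeConjectureFor_of_dim_le_three_holds`; §2 with `X = T`: the pieces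
`H¹ ⊗ H'³`, `H² ⊗ H'²`, `H³ ⊗ H'¹`, `H³ ⊗ H'³`, `H⁴ ⊗ H'²`). [cite: VoisinHodgeI2002, §7.1.1, §6.1.3 Cor. 6.13, §11.3.3 Thm. 11.38–11.40, Lemma 11.41 and pp. 285–287, §11.3.1 Thm. 11.30]
[cite: VoisinHodgeII2003, §9.2.4 Prop. 9.20, §10.2.3 proof of Prop. 10.26] [cite: DeligneHodgeII1971, 1.2.5 and 2.1.13] [cite: Deligne2000, §1] -/
theorem BettiUniverse.hodgeConjectureFor_fourfold_tensor_threefold_of_hodgeNumber_mul_eq_zero (hHD : exists_isReal_hodgeModel) (hF : IsSmoothProjective 4 F) (hT : IsSmoothProjective 3 T)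
    (hFT : IsSmoothProjective d (F ⊗ T)) (hHCF : HodgeConjectureFor 4 F)
    (a1 : (BettiUniverse.hodge hHD hF 1).hodgeNumber 1 0 * (BettiUniverse.hodge hHD hT 3).hodgeNumber 2 1 = 0)
    (a2 : (BettiUniverse.hodge hHD hF 2).hodgeNumber 2 0 * (BettiUniverse.hodge hHD hT 2).hodgeNumber 2 0 = 0)
    (a3 : (BettiUniverse.hodge hHD hF 3).hodgeNumber 2 1 * (BettiUniverse.hodge hHD hT 1).hodgeNumber 1 0 = 0)
    (a4 : (BettiUniverse.hodge hHD hF 3).hodgeNumber 2 1 * (BettiUniverse.hodge hHD hT 3).hodgeNumber 2 1 = 0)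
    (a5 : (BettiUniverse.hodge hHD hF 3).hodgeNumber 3 0 * (BettiUniverse.hodge hHD hT 3).hodgeNumber 3 0 = 0)
    (a6 : (BettiUniverse.hodge hHD hF 4).hodgeClasses 2 = ⊤ ∨ (BettiUniverse.hodge hHD hT 2).hodgeNumber 2 0 = 0) : HodgeConjectureFor d (F ⊗ T) := by
  refine BettiUniverse.hodgeConjectureFor_fourfold_tensor_of_hodgeNumber_mul_eq_zero hHD hF hT hFT hHCF (hodgeConjectureFor_of_dim_le_three_holds le_rfl hT)
    (fun b hb1 hb ↦ ?_) (fun b hb1 hb ↦ ?_) (fun b hb ↦ ?_) (fun u hu ↦ ?_) (fun b hb1 hb ↦ ?_)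
  · -- `h^{1,0}(F) · h^{1,2}(H³(T))`
    obtain rfl : b = 1 := by omega
    have key := a1
    rw [BettiUniverse.hodgeNumber_hodge_symm hHD hT 3 (2 : ℤ) 1] at key
    convert key using 3 <;> norm_num
  · -- `H²(F) ⊗ H²(T)` drops out
    obtain rfl : b = 1 := by omega
    rcases mul_eq_zero.1 a2 with h | h
    · exact Or.inl h
    · exact Or.inr ((BettiUniverse.hodgeClasses_hodge_two_eq_top_iff hHD hT).2 h)
  · -- `h^{2,1}(F) · h^{b,b+1}(H^{2b+1}(T))`, `b ∈ {0, 1}`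
    obtain rfl | rfl : b = 0 ∨ b = 1 := by omega
    · have key := a3
      rw [BettiUniverse.hodgeNumber_hodge_symm hHD hT 1 (1 : ℤ) 0] at key
      convert key using 3 <;> norm_num
    · have key := a4
      rw [BettiUniverse.hodgeNumber_hodge_symm hHD hT 3 (2 : ℤ) 1] at key
      convert key using 3 <;> norm_num
  · -- `h^{3,0}(F) · h^{0,3}(H³(T))`
    obtain rfl : u = 0 := by omega
    have key := a5
    rw [BettiUniverse.hodgeNumber_hodge_symm hHD hT 3 (3 : ℤ) 0] at key
    convert key using 3 <;> norm_num
  · -- `H⁴(F) ⊗ H²(T)` drops out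
    obtain rfl : b = 1 := by omega
    exact a6.imp id fun h ↦ (BettiUniverse.hodgeClasses_hodge_two_eq_top_iff hHD hT).2 h

/-- **`HC(F) ⟹ HC(F × T)` for every smooth projective threefold `T` with `h^{1,0}(T) = h^{2,0}(T) = h^{2,1}(T) = 0`** (e.g. a rigid Calabi–Yau threefold) **and `h^{3,0}(F)·h^{3,0}(T) = 0`**, `F` any
smooth projective fourfold. [cite: VoisinHodgeI2002, §7.1.1, §11.3.3 Thm. 11.38–11.40, Lemma 11.41 and pp. 285–287, §11.3.1 Thm. 11.30] [cite: VoisinHodgeII2003, §10.2.3 proof of Prop. 10.26] [cite: DeligneHodgeII1971, 1.2.5 and 2.1.13]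
[cite: Deligne2000, §1] -/
theorem BettiUniverse.hodgeConjectureFor_fourfold_tensor_threefold_of_hodgeNumber_eq_zero (hHD : exists_isReal_hodgeModel) (hF : IsSmoothProjective 4 F) (hT : IsSmoothProjective 3 T)
    (hFT : IsSmoothProjective d (F ⊗ T)) (hHCF : HodgeConjectureFor 4 F) (h10 : (BettiUniverse.hodge hHD hT 1).hodgeNumber 1 0 = 0) (h20 : (BettiUniverse.hodge hHD hT 2).hodgeNumber 2 0 = 0)
    (h21 : (BettiUniverse.hodge hHD hT 3).hodgeNumber 2 1 = 0) (h30 : (BettiUniverse.hodge hHD hF 3).hodgeNumber 3 0 * (BettiUniverse.hodge hHD hT 3).hodgeNumber 3 0 = 0) :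
    HodgeConjectureFor d (F ⊗ T) :=
  BettiUniverse.hodgeConjectureFor_fourfold_tensor_threefold_of_hodgeNumber_mul_eq_zero hHD hF hT hFT hHCF (by rw [h21, mul_zero]) (by rw [h20, mul_zero]) (by rw [h10, mul_zero])
    (by rw [h21, mul_zero]) h30 (Or.inr h20)

/-! ### §4 Two fourfolds -/

/-- **`HC(F × F')` for two smooth projective fourfolds with `HC(F)`, `HC(F')`** and: `h^{1,0}(F)·h^{2,1}(F') = 0`, `h^{2,0}(F)·h^{2,0}(F') = 0`, [`h^{2,0}(F) = 0` or `Hdg²(H⁴F') = ⊤`],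
`h^{2,1}(F)·h^{1,0}(F') = 0`, `h^{2,1}(F)·h^{2,1}(F') = 0`, `h^{3,0}(F)·h^{3,0}(F') = 0`, [`Hdg²(H⁴F) = ⊤` or `h^{2,0}(F') = 0`], [`Hdg²(H⁴F) = ⊤` or `Hdg²(H⁴F') = ⊤`] (§2 with `X = F'`: the pieces
`H¹ ⊗ H'³`, `H² ⊗ H'²`, `H² ⊗ H'⁴`, `H³ ⊗ H'¹`, `H³ ⊗ H'³`, `H⁴ ⊗ H'²`, `H⁴ ⊗ H'⁴`; one of the two `H⁴` must consist of Hodge classes).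
[cite: VoisinHodgeI2002, §7.1.1, §6.1.3 Cor. 6.13, §11.3.3 Thm. 11.38–11.40, Lemma 11.41 and pp. 285–287, §11.3.1 Thm. 11.30] [cite: VoisinHodgeII2003, §9.2.4 Prop. 9.20] [cite: DeligneHodgeII1971, 1.2.5 and 2.1.13] [cite: Deligne2000, §1] -/
theorem BettiUniverse.hodgeConjectureFor_tensor_fourfolds_of_hodgeNumber_mul_eq_zero (hHD : exists_isReal_hodgeModel) (hF : IsSmoothProjective 4 F) (hF' : IsSmoothProjective 4 F')
    (hFF' : IsSmoothProjective d (F ⊗ F')) (hHCF : HodgeConjectureFor 4 F) (hHCF' : HodgeConjectureFor 4 F')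
    (c1 : (BettiUniverse.hodge hHD hF 1).hodgeNumber 1 0 * (BettiUniverse.hodge hHD hF' 3).hodgeNumber 2 1 = 0)
    (c2 : (BettiUniverse.hodge hHD hF 2).hodgeNumber 2 0 * (BettiUniverse.hodge hHD hF' 2).hodgeNumber 2 0 = 0)
    (c3 : (BettiUniverse.hodge hHD hF 2).hodgeNumber 2 0 = 0 ∨ (BettiUniverse.hodge hHD hF' 4).hodgeClasses 2 = ⊤)
    (c4 : (BettiUniverse.hodge hHD hF 3).hodgeNumber 2 1 * (BettiUniverse.hodge hHD hF' 1).hodgeNumber 1 0 = 0)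
    (c5 : (BettiUniverse.hodge hHD hF 3).hodgeNumber 2 1 * (BettiUniverse.hodge hHD hF' 3).hodgeNumber 2 1 = 0)
    (c6 : (BettiUniverse.hodge hHD hF 3).hodgeNumber 3 0 * (BettiUniverse.hodge hHD hF' 3).hodgeNumber 3 0 = 0)
    (c7 : (BettiUniverse.hodge hHD hF 4).hodgeClasses 2 = ⊤ ∨ (BettiUniverse.hodge hHD hF' 2).hodgeNumber 2 0 = 0)
    (c8 : (BettiUniverse.hodge hHD hF 4).hodgeClasses 2 = ⊤ ∨ (BettiUniverse.hodge hHD hF' 4).hodgeClasses 2 = ⊤) : HodgeConjectureFor d (F ⊗ F') := by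
  refine BettiUniverse.hodgeConjectureFor_fourfold_tensor_of_hodgeNumber_mul_eq_zero hHD hF hF' hFF' hHCF hHCF'
    (fun b hb1 hb ↦ ?_) (fun b hb1 hb ↦ ?_) (fun b hb ↦ ?_) (fun u hu ↦ ?_) (fun b hb1 hb ↦ ?_)
  · -- `h^{1,0}(F) · h^{1,2}(H³(F'))` (`b = 1`; `2b + 1 ≤ 4`)
    obtain rfl : b = 1 := by omega
    have key := c1
    rw [BettiUniverse.hodgeNumber_hodge_symm hHD hF' 3 (2 : ℤ) 1] at key
    convert key using 3 <;> norm_num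
  · -- `H²(F) ⊗ H^{2b}(F')`, `b ∈ {1, 2}`
    obtain rfl | rfl : b = 1 ∨ b = 2 := by omega
    · rcases mul_eq_zero.1 c2 with h | h
      · exact Or.inl h
      · exact Or.inr ((BettiUniverse.hodgeClasses_hodge_two_eq_top_iff hHD hF').2 h)
    · exact c3
  · -- `h^{2,1}(F) · h^{b,b+1}(H^{2b+1}(F'))`, `b ∈ {0, 1}`
    obtain rfl | rfl : b = 0 ∨ b = 1 := by omega
    · have key := c4
      rw [BettiUniverse.hodgeNumber_hodge_symm hHD hF' 1 (1 : ℤ) 0] at key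
      convert key using 3 <;> norm_num
    · have key := c5
      rw [BettiUniverse.hodgeNumber_hodge_symm hHD hF' 3 (2 : ℤ) 1] at key
      convert key using 3 <;> norm_num
  · -- `h^{3,0}(F) · h^{0,3}(H³(F'))`
    obtain rfl : u = 0 := by omega
    have key := c6
    rw [BettiUniverse.hodgeNumber_hodge_symm hHD hF' 3 (3 : ℤ) 0] at key
    convert key using 3 <;> norm_num
  · -- `H⁴(F) ⊗ H^{2b}(F')`, `b ∈ {1, 2}`
    obtain rfl | rfl : b = 1 ∨ b = 2 := by omega
    · exact c7.imp id fun h ↦ (BettiUniverse.hodgeClasses_hodge_two_eq_top_iff hHD hF').2 h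
    · exact c8

end Literature.AlgebraicGeometry.HodgeTheory

/-! ### §5 The smooth cubic fourfold -/

namespace Literature.AlgebraicGeometry.HodgeTheory

open Literature.AlgebraicGeometry.Motives

/-- **`HC(X)` for every smooth cubic fourfold `X ⊂ ℙ⁵_ℂ`** (Zucker 1977, (3.2) Theorem; Murre 1977, Corollary), UNCONDITIONALLY in the tree: the assembly `hodgeConjectureFor_cubicFourfold_of` fed with
the discharged fact `hodgeTwoTwo_algebraic_cubicFourfold_holds`, Lefschetz `(1,1)` (`lefschetzOneOne_rational_holds`), hard Lefschetz (`nonempty_hardLefschetzNFold_holds`) and the Hodge model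
(`nonempty_hodgeModel_holds`). [cite: Zucker1977, (3.2) Theorem, p. 206] [cite: Murre1977, Theorem and Corollary, p. 230] [cite: Deligne2000, §1] -/
theorem hodgeConjectureFor_cubicFourfold_holds {X : SchemeOver ℂ} (hX : IsSmoothHypersurface 4 3 X) : HodgeConjectureFor 4 X :=
  hodgeConjectureFor_cubicFourfold_of hodgeTwoTwo_algebraic_cubicFourfold_holds lefschetzOneOne_rational_holds (nonempty_hardLefschetzNFold_holds 4 X) nonempty_hodgeModel_holds hX

end Literature.AlgebraicGeometry.HodgeTheory

namespace Literature.AlgebraicGeometry.Motives.IsSmoothHypersurface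

open Literature.AlgebraicGeometry.Motives
open Literature.AlgebraicGeometry.HodgeTheory

variable {d n : ℕ} {X C S T : SchemeOver ℂ}

/-- `h^{1,0} = 0` for a smooth cubic fourfold (`b₁ = 0`, Lefschetz). [cite: VoisinHodgeII2003, §1.2.3 Cor. 1.24–1.25] [cite: VoisinHodgeI2002, §6.1.3 Cor. 6.13] -/
theorem hodgeNumber_one_zero_cubicFourfold (hX : IsSmoothHypersurface 4 3 X) (hHD : exists_isReal_hodgeModel) : (BettiUniverse.hodge hHD hX.1 1).hodgeNumber 1 0 = 0 := by
  exact_mod_cast BettiUniverse.hodgeNumber_hodge_eq_zero_of_finrank_eq_zero hHD hX.1 (k := 1) (p := 1) (q := 0) rfl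
    (hX.finrank_bettiCohomology_eq_zero_of_odd (k := 1) odd_one (by norm_num))

/-- `h^{2,1} = 0` for a smooth cubic fourfold (`b₃ = 0`, Lefschetz). [cite: VoisinHodgeII2003, §1.2.3 Cor. 1.24–1.25] [cite: VoisinHodgeI2002, §6.1.3 Cor. 6.13] -/
theorem hodgeNumber_two_one_cubicFourfold (hX : IsSmoothHypersurface 4 3 X) (hHD : exists_isReal_hodgeModel) : (BettiUniverse.hodge hHD hX.1 3).hodgeNumber 2 1 = 0 := by
  exact_mod_cast BettiUniverse.hodgeNumber_hodge_eq_zero_of_finrank_eq_zero hHD hX.1 (k := 3) (p := 2) (q := 1) rfl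
    (hX.finrank_bettiCohomology_eq_zero_of_odd (k := 3) (by decide) (by norm_num))

/-- `h^{3,0} = 0` for a smooth cubic fourfold (`b₃ = 0`, Lefschetz). [cite: VoisinHodgeII2003, §1.2.3 Cor. 1.24–1.25] [cite: VoisinHodgeI2002, §6.1.3 Cor. 6.13] -/
theorem hodgeNumber_three_zero_cubicFourfold (hX : IsSmoothHypersurface 4 3 X) (hHD : exists_isReal_hodgeModel) : (BettiUniverse.hodge hHD hX.1 3).hodgeNumber 3 0 = 0 := by
  exact_mod_cast BettiUniverse.hodgeNumber_hodge_eq_zero_of_finrank_eq_zero hHD hX.1 (k := 3) (p := 3) (q := 0) rfl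
    (hX.finrank_bettiCohomology_eq_zero_of_odd (k := 3) (by decide) (by norm_num))

/-- `h^{2,0} = 0` for a smooth cubic fourfold (`H²(X;ℚ) = Hdg¹`, all of `H²` being algebraic off the middle degree). [cite: VoisinHodgeII2003, §1.2.3 Cor. 1.24–1.25] [cite: VoisinHodgeI2002, §7.1.1] -/
theorem hodgeNumber_two_zero_cubicFourfold (hX : IsSmoothHypersurface 4 3 X) (hHD : exists_isReal_hodgeModel) : (BettiUniverse.hodge hHD hX.1 2).hodgeNumber 2 0 = 0 :=
  (BettiUniverse.hodgeClasses_hodge_two_eq_top_iff hHD hX.1).1 (hX.hodgeClasses_hodge_eq_top_of_two_mul_ne hHD hX.1 (p := 1) (by norm_num))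

/-- **`HC(X × T)` for every smooth cubic fourfold `X ⊂ ℙ⁵_ℂ` and every smooth projective threefold `T` with `h^{2,0}(T) = 0`, unconditionally** (`HC(X)` by Zucker–Murre in the tree;
`h^{1,0}(X) = h^{2,0}(X) = h^{2,1}(X) = h^{3,0}(X) = 0`; the only piece of the reduced window that could survive is `H⁴(X) ⊗ H²(T)`, which drops out when `H²(T;ℚ)` consists of divisor classes).
[cite: Zucker1977, (3.2) Theorem, p. 206] [cite: Murre1977, Theorem and Corollary, p. 230] [cite: VoisinHodgeII2003, §1.2.3 Cor. 1.24–1.25, §10.2.3 proof of Prop. 10.26] [cite: VoisinHodgeI2002, §7.1.1, §11.3.3 Thm. 11.38–11.40, Lemma 11.41 and pp. 285–287, §11.3.1 Thm. 11.30]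
[cite: Deligne2000, §1] -/
theorem hodgeConjectureFor_cubicFourfold_tensor_threefold_of_h20_zero (hX : IsSmoothHypersurface 4 3 X) (hHD : exists_isReal_hodgeModel) (hT : IsSmoothProjective 3 T)
    (h20 : (BettiUniverse.hodge hHD hT 2).hodgeNumber 2 0 = 0) : HodgeConjectureFor 7 (X ⊗ T) := by
  haveI : HodgeTensorFacts.{0, 0} := hodgeTensorFacts_holds
  exact BettiUniverse.hodgeConjectureFor_fourfold_tensor_threefold_of_hodgeNumber_mul_eq_zero hHD hX.1 hT (hX.1.tensor_holds hT) (hodgeConjectureFor_cubicFourfold_holds hX)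
    (by rw [hX.hodgeNumber_one_zero_cubicFourfold hHD, zero_mul]) (by rw [hX.hodgeNumber_two_zero_cubicFourfold hHD, zero_mul])
    (by rw [hX.hodgeNumber_two_one_cubicFourfold hHD, zero_mul]) (by rw [hX.hodgeNumber_two_one_cubicFourfold hHD, zero_mul])
    (by rw [hX.hodgeNumber_three_zero_cubicFourfold hHD, zero_mul]) (Or.inr h20)

/-- **`HC(X × S)` for every smooth cubic fourfold `X` and every smooth projective surface `S` with `p_g(S) = h^{2,0}(S) = 0`, unconditionally** (the reduced window of `X × S` is `H³(X) ⊗ H¹(S) = 0`,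
`H²(X) ⊗ H²(S)`, `H⁴(X) ⊗ H²(S)`; the even pieces drop out when `H²(S;ℚ) = NS(S)_ℚ`). [cite: Zucker1977, (3.2) Theorem, p. 206] [cite: Murre1977, Theorem and Corollary, p. 230] [cite: VoisinHodgeII2003, §1.2.3 Cor. 1.24–1.25]
[cite: VoisinHodgeI2002, §7.1.1, §11.3.3 Thm. 11.38–11.40, Lemma 11.41 and pp. 285–287, §11.3.1 Thm. 11.30] [cite: Deligne2000, §1] -/
theorem hodgeConjectureFor_cubicFourfold_tensor_surface_of_pg_zero (hX : IsSmoothHypersurface 4 3 X) (hHD : exists_isReal_hodgeModel) (hS : IsSmoothProjective 2 S)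
    (hpg : (BettiUniverse.hodge hHD hS 2).hodgeNumber 2 0 = 0) : HodgeConjectureFor 6 (X ⊗ S) := by
  haveI : HodgeTensorFacts.{0, 0} := hodgeTensorFacts_holds
  have hS2 : (BettiUniverse.hodge hHD hS 2).hodgeClasses 1 = ⊤ := (BettiUniverse.hodgeClasses_hodge_two_eq_top_iff hHD hS).2 hpg
  refine BettiUniverse.hodgeConjectureFor_fourfold_tensor_of_hodgeNumber_mul_eq_zero hHD hX.1 hS (hX.1.tensor_holds hS) (hodgeConjectureFor_cubicFourfold_holds hX)
    (hodgeConjectureFor_of_dim_le_three_holds (by norm_num) hS) (fun b hb1 hb ↦ by omega) (fun b hb1 hb ↦ ?_) (fun b hb ↦ ?_) (fun u hu ↦ by omega) (fun b hb1 hb ↦ ?_)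
  · obtain rfl : b = 1 := by omega
    exact Or.inr hS2
  · obtain rfl : b = 0 := by omega
    rw [hX.hodgeNumber_two_one_cubicFourfold hHD, zero_mul]
  · obtain rfl : b = 1 := by omega
    exact Or.inr hS2

/-- **`HC(X × C)` for every smooth cubic fourfold `X` and every smooth projective curve `C`, unconditionally** (the reduced window of `X × C` is the single piece `H³(X) ⊗ H¹(C) = 0`).
[cite: Zucker1977, (3.2) Theorem, p. 206] [cite: Murre1977, Theorem and Corollary, p. 230] [cite: VoisinHodgeII2003, §1.2.3 Cor. 1.24–1.25] [cite: VoisinHodgeI2002, §11.3.3 Thm. 11.38–11.40, Lemma 11.41 and pp. 285–287, §11.3.1 Thm. 11.30]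
[cite: Deligne2000, §1] -/
theorem hodgeConjectureFor_cubicFourfold_tensor_curve (hX : IsSmoothHypersurface 4 3 X) (hHD : exists_isReal_hodgeModel) (hC : IsSmoothProjective 1 C) : HodgeConjectureFor 5 (X ⊗ C) := by
  haveI : HodgeTensorFacts.{0, 0} := hodgeTensorFacts_holds
  refine BettiUniverse.hodgeConjectureFor_fourfold_tensor_of_hodgeNumber_mul_eq_zero hHD hX.1 hC (hX.1.tensor_holds hC) (hodgeConjectureFor_cubicFourfold_holds hX)
    (hodgeConjectureFor_of_dim_le_three_holds (by norm_num) hC) (fun b hb1 hb ↦ by omega) (fun b hb1 hb ↦ by omega) (fun b hb ↦ ?_) (fun u hu ↦ by omega) (fun b hb1 hb ↦ by omega)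
  obtain rfl : b = 0 := by omega
  rw [hX.hodgeNumber_two_one_cubicFourfold hHD, zero_mul]

end Literature.AlgebraicGeometry.Motives.IsSmoothHypersurface

end
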